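import Mathlib
import HarnessLib
import Summits.HubbardSuperconductivity.HubbardSuperconductivity.Theorems.KLProgrammeC4aPartnerBandCooperDefect
import Summits.HubbardSuperconductivity.HubbardSuperconductivity.Theorems.KLProgrammeC4aRadialRowsTwoThree
import Summits.HubbardSuperconductivity.HubbardSuperconductivity.Theorems.KLProgrammePerturbedFermiCurveCompChain

/-!
# Route `KLProgramme` — crux C4a, S3 brick (B2, Cooper, ORDER 2): the second t-derivative of the partner band of the co-moving bubble loop near Cooper is
# `O(|ρ| + |ϑ − π|)`, uniformly in the loop variables

Cell `gate-hubbard-kl`, lane hubbard-kl-c4a-1 (g6); helper for stub (C) `stub_twoLeg_curvature` of the engine-flow child `KLRegimeEngineV17F2`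
(stmt-HubbardSuperconductivity-20437); memo HOME/hubbard-kl-c4a-1/C4A-PLAN.md §24.4 (i), §24.6 (B2).  Sequel to `…C4aPartnerBandCooperDefect` (orders 0, 1).  With
`ē(t) = e_K(S(t) − γ(t))`, `S = pairSumPath μ K ρ ϑ θ`, `γ(t) = Φ(e, α+t)`, and the reference `e_K(−γ(t)) ≡ e`:

* §1 `abs_iteratedDeriv_two_comp_sub_le` — a carrier-free calculus lemma: for `f : V → ℝ` with `‖Df‖ ≤ K₁`, `‖D²f‖ ≤ K₂`, `‖D³f‖ ≤ K₃`, curves `S, γ` with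
  `f(−γ(t)) ≡ e`, and sizes `‖S(0)‖ ≤ s₀`, `‖S′(0)‖ ≤ s₁`, `‖S″(0)‖ ≤ s₂`, `‖γ′(0)‖ ≤ m₁`, `‖γ″(0)‖ ≤ m₂`:
  `|∂_t²|₀ f(S(t) − γ(t))| ≤ K₂·(s₁² + 2s₁m₁) + K₃·s₀·m₁² + K₁·s₂ + K₂·s₀·m₂` (second-order chain rule `…PerturbedFermiCurveCompChain.iteratedDeriv_two_comp_eq` on both
  composites, the reference one vanishing, bilinear expansion, Lipschitz bounds of `Df`, `D²f`);
* §2 **`abs_iteratedDeriv_two_partnerBand_pp_le`** — the instantiation with g5's rigidity (`‖S(0)‖ ≤ |ρ|/d + msD₁|ϑ−π|`, `‖S′(0)‖ ≤ RR1·|ρ| + msD₂|ϑ−π|`,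
  `‖S″(0)‖ ≤ Lrad₂|ρ| + msD₃|ϑ−π|`) and the single-frame table (`‖γ′‖ ≤ msD₁`, `‖γ″‖ ≤ msD₂`): every term carries a factor `|ρ|` or `|ϑ − π|`.

Pure calculus; nothing about the model's sizes; nothing asserts superconductivity.  References: FST II CPAM 51 (1998) §3 Thm 3.5; BGM 2006 §2.4 (2.40) [cite: BenfattoGiulianiMastropietro2006].
-/

noncomputable section

namespace Summit.HubbardSuperconductivity.HubbardSuperconductivity.Theorems.C4a

set_option linter.dupNamespace false -- summit = problem name (single-conjunct summit), D-0017

open Real Set Filter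
open scoped Topology
open Literature.MathematicalPhysics.QuantumLattice Literature.MathematicalPhysics.QuantumLattice.BandSectorCounting Literature.Probability.LatticeModels
open Summit.HubbardSuperconductivity.HubbardSuperconductivity.Theorems.KLRegimeSplit
open Summit.HubbardSuperconductivity.HubbardSuperconductivity.Theorems.DispersionFlow
open Summit.HubbardSuperconductivity.HubbardSuperconductivity.Theorems.PerturbedFermiCurve

/-! ## §1 The carrier-free second-order lemma -/

section Abstract

variable {V : Type*} [NormedAddCommGroup V] [NormedSpace ℝ V]

/-- **Second t-derivative of `f(S(t) − γ(t))` against the rigid reference `f(−γ(t)) ≡ e`.** -/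
theorem abs_iteratedDeriv_two_comp_sub_le {f : V → ℝ} (hf : ContDiff ℝ 4 f) {K₁ K₂ K₃ : ℝ} (hK₁ : ∀ x, ‖fderiv ℝ f x‖ ≤ K₁)
    (hK₂ : ∀ x, ‖iteratedFDeriv ℝ 2 f x‖ ≤ K₂) (hK₃ : ∀ x, ‖iteratedFDeriv ℝ 3 f x‖ ≤ K₃) {S γ : ℝ → V} (hS : ContDiff ℝ 4 S) (hγ : ContDiff ℝ 4 γ)
    {e : ℝ} (href : ∀ t, f (-γ t) = e) {s₀ s₁ s₂ m₁ m₂ : ℝ} (hs₀ : ‖S 0‖ ≤ s₀) (hs₁ : ‖iteratedDeriv 1 S 0‖ ≤ s₁) (hs₂ : ‖iteratedDeriv 2 S 0‖ ≤ s₂)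
    (hm₁ : ‖iteratedDeriv 1 γ 0‖ ≤ m₁) (hm₂ : ‖iteratedDeriv 2 γ 0‖ ≤ m₂) :
    |iteratedDeriv 2 (fun t : ℝ => f (S t - γ t)) 0| ≤ K₂ * (s₁ ^ 2 + 2 * s₁ * m₁) + K₃ * s₀ * m₁ ^ 2 + K₁ * s₂ + K₂ * s₀ * m₂ := by
  have hK₁0 : 0 ≤ K₁ := (norm_nonneg _).trans (hK₁ 0)
  have hK₂0 : 0 ≤ K₂ := (norm_nonneg _).trans (hK₂ 0)
  have hK₃0 : 0 ≤ K₃ := (norm_nonneg _).trans (hK₃ 0)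
  have hs00 : 0 ≤ s₀ := (norm_nonneg _).trans hs₀
  have hs10 : 0 ≤ s₁ := (norm_nonneg _).trans hs₁
  have hm10 : 0 ≤ m₁ := (norm_nonneg _).trans hm₁
  have hm20 : 0 ≤ m₂ := (norm_nonneg _).trans hm₂
  -- the two composites and their second derivatives
  have hc : ContDiff ℝ 4 (fun t : ℝ => S t - γ t) := hS.sub hγ
  have hn : ContDiff ℝ 4 (fun t : ℝ => -γ t) := hγ.neg
  have h1 := iteratedDeriv_two_comp_eq hf hc 0
  have h2 := iteratedDeriv_two_comp_eq hf hn 0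
  have hc1 : iteratedDeriv 1 (fun t : ℝ => S t - γ t) 0 = iteratedDeriv 1 S 0 - iteratedDeriv 1 γ 0 :=
    iteratedDeriv_fun_sub (hS.contDiffAt.of_le (by norm_num)) (hγ.contDiffAt.of_le (by norm_num))
  have hc2 : iteratedDeriv 2 (fun t : ℝ => S t - γ t) 0 = iteratedDeriv 2 S 0 - iteratedDeriv 2 γ 0 :=
    iteratedDeriv_fun_sub (hS.contDiffAt.of_le (by norm_num)) (hγ.contDiffAt.of_le (by norm_num))
  have hn1 : iteratedDeriv 1 (fun t : ℝ => -γ t) 0 = -iteratedDeriv 1 γ 0 := iteratedDeriv_fun_neg 1 γ 0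
  have hn2 : iteratedDeriv 2 (fun t : ℝ => -γ t) 0 = -iteratedDeriv 2 γ 0 := iteratedDeriv_fun_neg 2 γ 0
  -- the reference composite is constant, so its second derivative vanishes
  have href2 : iteratedDeriv 2 (f ∘ fun t : ℝ => -γ t) 0 = 0 := by
    rw [show (f ∘ fun t : ℝ => -γ t) = fun _ => e from funext fun t => href t, iteratedDeriv_const]; simp
  rw [h2, hn1, hn2] at href2
  -- abbreviations
  set x := S 0 - γ 0 with hx
  set y := -γ 0 with hy
  set a := iteratedDeriv 1 S 0
  set b := iteratedDeriv 1 γ 0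
  set a₂ := iteratedDeriv 2 S 0
  set b₂ := iteratedDeriv 2 γ 0
  set L₂ := fderiv ℝ (fderiv ℝ f) with hL₂
  have hxy : x - y = S 0 := by rw [hx, hy]; abel
  -- rewrite the target
  have hfun : (fun t : ℝ => f (S t - γ t)) = f ∘ fun t : ℝ => S t - γ t := rfl
  rw [hfun, h1, hc1, hc2]
  -- bilinear bookkeeping: write everything against the reference identity `L₂ y (-b) (-b) + Df y (-b₂) = 0`
  have key : L₂ x (a - b) (a - b) + fderiv ℝ f x (a₂ - b₂) =
      (L₂ x a a - L₂ x a b - L₂ x b a) + (L₂ x - L₂ y) b b + fderiv ℝ f x a₂ - (fderiv ℝ f x - fderiv ℝ f y) b₂ +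
        (L₂ y (-b) (-b) + fderiv ℝ f y (-b₂)) := by
    simp only [map_sub, map_neg, neg_neg, show ∀ (P : V →L[ℝ] ℝ) (u : V), (-P) u = -(P u) from fun P u => rfl,
      show ∀ (P Q : V →L[ℝ] V →L[ℝ] ℝ) (u : V), (P - Q) u = P u - Q u from fun P Q u => rfl,
      show ∀ (P Q : V →L[ℝ] ℝ) (u : V), (P - Q) u = P u - Q u from fun P Q u => rfl]
    ring
  rw [key, href2, add_zero]
  -- norms of the operators
  have hL₂x : ‖L₂ x‖ ≤ K₂ := by rw [hL₂, norm_fderiv_two_eq_norm_iteratedFDeriv]; exact hK₂ x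
  have hLip₂ : ‖L₂ x - L₂ y‖ ≤ K₃ * ‖S 0‖ := by
    have hdiff : Differentiable ℝ (fderiv ℝ (fderiv ℝ f)) := ((hf.fderiv_right (m := 3) (by norm_num)).fderiv_right (m := 2) (by norm_num)).differentiable
      (by norm_num)
    have h := (convex_univ (𝕜 := ℝ) (E := V)).norm_image_sub_le_of_norm_fderiv_le (𝕜 := ℝ) (f := fderiv ℝ (fderiv ℝ f)) (fun z _ => hdiff z)
      (fun z _ => by rw [norm_fderiv_three_eq_norm_iteratedFDeriv]; exact hK₃ z) (mem_univ y) (mem_univ x)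
    rwa [hxy] at h
  have hLip₁ : ‖fderiv ℝ f x - fderiv ℝ f y‖ ≤ K₂ * ‖S 0‖ := by
    have hdiff : Differentiable ℝ (fderiv ℝ f) := (hf.fderiv_right (m := 3) (by norm_num)).differentiable (by norm_num)
    have h := (convex_univ (𝕜 := ℝ) (E := V)).norm_image_sub_le_of_norm_fderiv_le (𝕜 := ℝ) (f := fderiv ℝ f) (fun z _ => hdiff z)
      (fun z _ => by rw [norm_fderiv_two_eq_norm_iteratedFDeriv]; exact hK₂ z) (mem_univ y) (mem_univ x)
    rwa [hxy] at h
  -- the five pieces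
  have t1 : |L₂ x a a| ≤ K₂ * (s₁ * s₁) := by
    rw [← Real.norm_eq_abs]; refine ((L₂ x).le_opNorm₂ a a).trans ?_
    calc ‖L₂ x‖ * ‖a‖ * ‖a‖ ≤ K₂ * s₁ * s₁ := by gcongr
      _ = K₂ * (s₁ * s₁) := by ring
  have t2 : |L₂ x a b| ≤ K₂ * (s₁ * m₁) := by
    rw [← Real.norm_eq_abs]; refine ((L₂ x).le_opNorm₂ a b).trans ?_
    calc ‖L₂ x‖ * ‖a‖ * ‖b‖ ≤ K₂ * s₁ * m₁ := by gcongr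
      _ = K₂ * (s₁ * m₁) := by ring
  have t3 : |L₂ x b a| ≤ K₂ * (s₁ * m₁) := by
    rw [← Real.norm_eq_abs]; refine ((L₂ x).le_opNorm₂ b a).trans ?_
    calc ‖L₂ x‖ * ‖b‖ * ‖a‖ ≤ K₂ * m₁ * s₁ := by gcongr
      _ = K₂ * (s₁ * m₁) := by ring
  have t4 : |(L₂ x - L₂ y) b b| ≤ K₃ * s₀ * m₁ ^ 2 := by
    have hP : ‖L₂ x - L₂ y‖ ≤ K₃ * s₀ := hLip₂.trans (mul_le_mul_of_nonneg_left hs₀ hK₃0)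
    have hP0 : 0 ≤ K₃ * s₀ := mul_nonneg hK₃0 hs00
    rw [← Real.norm_eq_abs]; refine ((L₂ x - L₂ y).le_opNorm₂ b b).trans ?_
    calc ‖L₂ x - L₂ y‖ * ‖b‖ * ‖b‖ ≤ (K₃ * s₀) * m₁ * m₁ := by gcongr
      _ = K₃ * s₀ * m₁ ^ 2 := by ring
  have t5 : |fderiv ℝ f x a₂| ≤ K₁ * s₂ := by
    rw [← Real.norm_eq_abs]; refine ((fderiv ℝ f x).le_opNorm a₂).trans ?_
    gcongr
    · exact hK₁ x
  have t6 : |(fderiv ℝ f x - fderiv ℝ f y) b₂| ≤ K₂ * s₀ * m₂ := by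
    have hQ : ‖fderiv ℝ f x - fderiv ℝ f y‖ ≤ K₂ * s₀ := hLip₁.trans (mul_le_mul_of_nonneg_left hs₀ hK₂0)
    have hQ0 : 0 ≤ K₂ * s₀ := mul_nonneg hK₂0 hs00
    rw [← Real.norm_eq_abs]; refine ((fderiv ℝ f x - fderiv ℝ f y).le_opNorm b₂).trans ?_
    calc ‖fderiv ℝ f x - fderiv ℝ f y‖ * ‖b₂‖ ≤ (K₂ * s₀) * m₂ := by gcongr
      _ = K₂ * s₀ * m₂ := by ring
  have e1 : |L₂ x a a - L₂ x a b - L₂ x b a| ≤ K₂ * (s₁ * s₁) + K₂ * (s₁ * m₁) + K₂ * (s₁ * m₁) :=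
    (abs_sub _ _).trans (add_le_add ((abs_sub _ _).trans (add_le_add t1 t2)) t3)
  calc |L₂ x a a - L₂ x a b - L₂ x b a + (L₂ x - L₂ y) b b + fderiv ℝ f x a₂ - (fderiv ℝ f x - fderiv ℝ f y) b₂|
      ≤ |L₂ x a a - L₂ x a b - L₂ x b a| + |(L₂ x - L₂ y) b b| + |fderiv ℝ f x a₂| + |(fderiv ℝ f x - fderiv ℝ f y) b₂| := by
        refine (abs_sub _ _).trans (add_le_add ((abs_add_le _ _).trans (add_le_add (abs_add_le _ _) le_rfl)) le_rfl)
    _ ≤ (K₂ * (s₁ * s₁) + K₂ * (s₁ * m₁) + K₂ * (s₁ * m₁)) + K₃ * s₀ * m₁ ^ 2 + K₁ * s₂ + K₂ * s₀ * m₂ := by gcongr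
    _ = K₂ * (s₁ ^ 2 + 2 * s₁ * m₁) + K₃ * s₀ * m₁ ^ 2 + K₁ * s₂ + K₂ * s₀ * m₂ := by ring

end Abstract

/-! ## §2 The instantiation at the co-moving pp loop near Cooper -/

section Sizes

variable {K : TrigPolyC4v} {A : ℝ} (hA : ∀ p : Momentum, ∀ j ≤ 2, ‖iteratedFDeriv ℝ j (frameShift K) p‖ ≤ A) (hA20 : A ≤ 1 / 20)
  (hd : klCurveD ≤ (bandBounds (show (-4 : ℝ) < -1.1 by norm_num) (show (-1.1 : ℝ) ≤ -0.1 by norm_num)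
    (show (-0.1 : ℝ) < 0 by norm_num)).Dtmin - 2 * A)
  {μ r : ℝ} (hr : 0 < r) (hlo : (-1.1 : ℝ) < μ - r - A) (hhi : μ + r + A < -0.1)
  {A₃ A₄ : ℝ} (hA₃ : ∀ p : Momentum, ‖iteratedFDeriv ℝ 3 (frameShift K) p‖ ≤ A₃)
  (hA₄ : ∀ p : Momentum, ‖iteratedFDeriv ℝ 4 (frameShift K) p‖ ≤ A₄)
  {K₁ K₂ K₃ : ℝ} (hK₁ : ∀ p : Momentum, ‖fderiv ℝ (frameLevel μ K) p‖ ≤ K₁) (hK₂ : ∀ p : Momentum, ‖iteratedFDeriv ℝ 2 (frameLevel μ K) p‖ ≤ K₂)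
  (hK₃ : ∀ p : Momentum, ‖iteratedFDeriv ℝ 3 (frameLevel μ K) p‖ ≤ K₃)
include hA hA20 hd hr hlo hhi hA₃ hA₄ hK₁ hK₂ hK₃

/-- **ORDER 2 — THE ANISOTROPY DEFECT NEAR COOPER, second t-derivative**: for every loop level `|e| < r` and loop angle `α`,
`|∂_t²|₀ e_K(S(t) − Φ(e, α+t))| ≤ K₂(s₁² + 2s₁msD₁) + K₃·s₀·msD₁² + K₁·s₂ + K₂·s₀·msD₂` with `s₀ = |ρ|/d + msD₁|ϑ−π|`, `s₁ = RR1·|ρ| + msD₂|ϑ−π|`,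
`s₂ = Lrad₂|ρ| + msD₃|ϑ−π|` — every term is `O(|ρ| + |ϑ − π|)`. -/
theorem abs_iteratedDeriv_two_partnerBand_pp_le {ρ : ℝ} (hρ : |ρ| < r) {e : ℝ} (he : |e| < r) (ϑ θ α : ℝ) :
    |iteratedDeriv 2 (fun t : ℝ => frameLevel μ K (pairSumPath μ K ρ ϑ θ t - levelPoint μ K e (α + t))) 0| ≤
      K₂ * ((radialRowOneConst A ((bandBounds (show (-4 : ℝ) < -1.1 by norm_num) (show (-1.1 : ℝ) ≤ -0.1 by norm_num) (show (-0.1 : ℝ) < 0 by norm_num)).Dtmin -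
            2 * A) * |ρ| + msD A₃ A₄ 2 * |ϑ - π|) ^ 2 +
          2 * (radialRowOneConst A ((bandBounds (show (-4 : ℝ) < -1.1 by norm_num) (show (-1.1 : ℝ) ≤ -0.1 by norm_num) (show (-0.1 : ℝ) < 0 by norm_num)).Dtmin -
            2 * A) * |ρ| + msD A₃ A₄ 2 * |ϑ - π|) * msD A₃ A₄ 1) +
        K₃ * (|ρ| / ((bandBounds (show (-4 : ℝ) < -1.1 by norm_num) (show (-1.1 : ℝ) ≤ -0.1 by norm_num) (show (-0.1 : ℝ) < 0 by norm_num)).Dtmin - 2 * A) +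
          msD A₃ A₄ 1 * |ϑ - π|) * msD A₃ A₄ 1 ^ 2 +
        K₁ * ((uRowTwoConst A A₃ ((bandBounds (show (-4 : ℝ) < -1.1 by norm_num) (show (-1.1 : ℝ) ≤ -0.1 by norm_num) (show (-0.1 : ℝ) < 0 by norm_num)).Dtmin -
            2 * A) + 1 / ((bandBounds (show (-4 : ℝ) < -1.1 by norm_num) (show (-1.1 : ℝ) ≤ -0.1 by norm_num) (show (-0.1 : ℝ) < 0 by norm_num)).Dtmin - 2 * A) +
            2 * (radialRowOneConst A ((bandBounds (show (-4 : ℝ) < -1.1 by norm_num) (show (-1.1 : ℝ) ≤ -0.1 by norm_num)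
              (show (-0.1 : ℝ) < 0 by norm_num)).Dtmin - 2 * A) -
              1 / ((bandBounds (show (-4 : ℝ) < -1.1 by norm_num) (show (-1.1 : ℝ) ≤ -0.1 by norm_num) (show (-0.1 : ℝ) < 0 by norm_num)).Dtmin - 2 * A))) * |ρ| +
          msD A₃ A₄ 3 * |ϑ - π|) +
        K₂ * (|ρ| / ((bandBounds (show (-4 : ℝ) < -1.1 by norm_num) (show (-1.1 : ℝ) ≤ -0.1 by norm_num) (show (-0.1 : ℝ) < 0 by norm_num)).Dtmin - 2 * A) +
          msD A₃ A₄ 1 * |ϑ - π|) * msD A₃ A₄ 2 := by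
  set B₀ := bandBounds (show (-4 : ℝ) < -1.1 by norm_num) (show (-1.1 : ℝ) ≤ -0.1 by norm_num) (show (-0.1 : ℝ) < 0 by norm_num) with hB₀
  have hADt : 2 * A < B₀.Dtmin := by have := klCurveD_pos; linarith
  have hS : ContDiff ℝ 4 (pairSumPath μ K ρ ϑ θ) := contDiff_pairSumPath B₀ hA hADt hr hlo hhi hρ ϑ θ
  have hγ : ContDiff ℝ 4 (fun t : ℝ => levelPoint μ K e (α + t)) := (contDiff_levelPoint_angle B₀ hA hADt hlo hhi he).comp (contDiff_const.add contDiff_id)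
  have href : ∀ t : ℝ, frameLevel μ K (-levelPoint μ K e (α + t)) = e := fun t => frameLevel_neg_levelPoint_tube hA hlo hhi he (α + t)
  have hs₀ := norm_pairSumPath_zero_le hA hA20 hd hr hlo hhi hA₃ hA₄ hρ ϑ θ
  have hs₁ := norm_deriv_pairSumPath_le_rigid hA hA20 hd hr hlo hhi hA₃ hA₄ hρ ϑ θ
  have hs₂ := norm_iteratedDeriv_pairSumPath_le_rigid hA hA20 hd hr hlo hhi hA₃ hA₄ hρ (i := 2) (by norm_num)
    (fun s => norm_iteratedDeriv_two_levelPoint_sub_le hA hA20 hd hr hlo hhi hA₃ hA₄ hρ s) ϑ θ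
  have hγ1 : ‖iteratedDeriv 1 (fun t : ℝ => levelPoint μ K e (α + t)) 0‖ ≤ msD A₃ A₄ 1 := by
    rw [iteratedDeriv_comp_const_add 1 (levelPoint μ K e) α]
    show ‖iteratedDeriv 1 (levelPoint μ K e) (α + 0)‖ ≤ _
    rw [add_zero]
    exact norm_iteratedDeriv_levelPoint_le hA hA20 hd hlo hhi hA₃ hA₄ he (i := 1) le_rfl (by norm_num) α
  have hγ2 : ‖iteratedDeriv 2 (fun t : ℝ => levelPoint μ K e (α + t)) 0‖ ≤ msD A₃ A₄ 2 := by
    rw [iteratedDeriv_comp_const_add 2 (levelPoint μ K e) α]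
    show ‖iteratedDeriv 2 (levelPoint μ K e) (α + 0)‖ ≤ _
    rw [add_zero]
    exact norm_iteratedDeriv_levelPoint_le hA hA20 hd hlo hhi hA₃ hA₄ he (i := 2) (by norm_num) (by norm_num) α
  exact abs_iteratedDeriv_two_comp_sub_le (EngineV8.contDiff_frameLevel μ K) hK₁ hK₂ hK₃ hS hγ href hs₀ hs₁ hs₂ hγ1 hγ2

end Sizes

end Summit.HubbardSuperconductivity.HubbardSuperconductivity.Theorems.C4a

end
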